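import Literature.NumberTheory.Automorphic.SmoothInductionNontrivial
import Literature.NumberTheory.Automorphic.CMPrincipalSeriesSpherical
import Literature.NumberTheory.Automorphic.JacquetModule
import Literature.NumberTheory.Automorphic.LocalConstantsProofs
import Literature.Topology.Algebra.CircleNoSmallSubgroups
import HarnessLib

/-!
# Evaluation at `1` on an induced representation descends to the Jacquet module; the closed cell contributes a non-zero class

Topic `NumberTheory/Automorphic`; namespace `Literature.NumberTheory.Automorphic` (and `NonarchimedeanGroup` for §1).  THEOREMS ONLY: no
definition, no named fact, no `sorry`, no instance, no notation.  Registry pub/hodgecm-mathlib F0∕P3, line `F0_P3_KeysCaseTwoPaydown`, node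
N1 (★ `UnitaryGroup.U3PrincipalSeriesJacquetFiltration`, [Casselman1995, Lemma 7.1.1 (a)]) — the second LOWER-BOUND ingredient «the closed
Bruhat cell contributes a non-zero class to `r_P i_P^G σ`», i.e. `ev₁ ≠ 0` on the Jacquet module, in generic form; the sibling ★-to-be
`SmoothIndOpenCellHaarFunctional` is the open-cell half.

## The mathematics ([BernsteinZelevinsky1977, §1.8, §2.3, Geometrical Lemma 2.12 (closed orbit)]; [Casselman1995, §6.3, Lemma 7.1.1 (a)])

For a parabolic triple `t = (P, M, N)` (★ `ParabolicTriple`) whose `N` is the union of its compact open subgroups (★ `IsLimitOfCompactOpen`),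
`δ_P^{1/2}` is trivial on `N` (§3: every `n ∈ N` lies in a compact subgroup of `P`, ★ `rootDeltaChar_eq_one_of_mem_of_isCompact`); hence the
inducing representation `σ ∘ proj ⊗ δ_P^{1/2}` of ★ `Representation.normalizedInd` is trivial on `N`, and evaluation at `1`,
`f ↦ f(1)`, is `N`-invariant on `i_P^G σ` (`(n · f)(1) = f(n) = f(1)`), so it DESCENDS to a linear map `E` on the Jacquet-module carrier
`(t.restrict (i_P^G σ)).Coinvariants` with `E [f] = f(1)` (§4, `ParabolicTriple.exists_linearMap_coinvariants_mk_eq_toFun_one`); in particular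
`[f] ≠ 0` whenever `f(1) ≠ 0`, and `E` kills the classes of the functions vanishing at `1` (the open-cell part).  §5 repackages ★
`SmoothInductionNontrivial.exists_mem_fixedPoints_toFun_eq_of_isOpen`: a vector `w` fixed by `(σ∘proj ⊗ δ^{1/2})(P ∩ K)` for an open subgroup `K`
is the value at `1` of a `K`-fixed section, so `E ≠ 0`.  §1–§2 supply the open subgroup for CONTINUOUS one-dimensional data over a
non-archimedean group: `NonarchimedeanGroup` passes to subgroups and along topological embeddings, and a continuous `φ : B →* ℂˣ` on a subgroup
`B` of a non-archimedean group is trivial on `B ∩ K` for some open subgroup `K` (★ `unitsComplex_noSmallSubgroups`).  The CM discharge for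
★ `cmPrincipalSeries` (open subgroups of `U(Φ_N)(L⁺_v)`, continuity of the Levi projection of the Borel) is the sequel file.

HC_CM is proved only modulo the printed citations until rung 0 closes; this file alone discharges no named fact.

## References
* [BernsteinZelevinsky1977] I. N. Bernstein, A. V. Zelevinsky, *Induced representations of reductive `p`-adic groups. I*, Ann. Sci. ÉNS (4)
  10 (1977), 1.7, §1.8–1.9, §2.3, Geometrical Lemma 2.12.
* [Casselman1995] W. Casselman, *Introduction to the theory of admissible representations of `p`-adic reductive groups* (draft 1 May
  1995), §6.3 (Thm. 6.3.5), Lemma 7.1.1 (a).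
* [CartierCorvallis1979] P. Cartier, *Representations of 𝔭-adic groups: a survey*, Proc. Symp. Pure Math. 33.1 (1979), §III.3 (`δ_P` on
  compact subgroups), §I.1 (no small subgroups).
-/

set_option autoImplicit false

noncomputable section

open scoped Pointwise
open Topology

/-! ## §1 `NonarchimedeanGroup` passes along topological embeddings and to subgroups -/

namespace NonarchimedeanGroup

variable {G H : Type*} [Group G] [TopologicalSpace G] [Group H] [TopologicalSpace H]

/-- **A topological group embedded (as a topological group) into a non-archimedean group is non-archimedean**: the preimages of
the open subgroups of `H` form a neighbourhood basis of `1` in `G`. [cite: CartierCorvallis1979, §I.1] -/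
theorem of_isEmbedding [NonarchimedeanGroup H] [IsTopologicalGroup G] (f : G →* H) (hf : IsEmbedding f) :
    NonarchimedeanGroup G where
  is_nonarchimedean U hU := by
    rw [hf.nhds_eq_comap, map_one] at hU
    obtain ⟨U', hU', hsub⟩ := hU
    obtain ⟨V, hV⟩ := NonarchimedeanGroup.is_nonarchimedean U' hU'
    exact ⟨⟨V.toSubgroup.comap f, (V.isOpen.preimage hf.continuous)⟩, fun x hx => hsub (hV hx)⟩

/-- **A subgroup of a non-archimedean group is non-archimedean** (subspace topology). [cite: CartierCorvallis1979, §I.1] -/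
theorem subgroup [NonarchimedeanGroup G] (S : Subgroup G) : NonarchimedeanGroup S :=
  of_isEmbedding S.subtype IsEmbedding.subtypeVal

end NonarchimedeanGroup

namespace Literature.NumberTheory.Automorphic

/-! ## §2 No small subgroups: a continuous `ℂˣ`-valued character of a subgroup is trivial near `1` -/

section NoSmall

variable {G : Type*} [Group G] [TopologicalSpace G]

/-- **A continuous character `φ : B →* ℂˣ` of a subgroup `B` of a non-archimedean group is trivial on `B ∩ K` for some OPEN SUBGROUP `K`
of the ambient group** (`ℂˣ` has no small subgroups, ★ `unitsComplex_noSmallSubgroups`; the relative form of ★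
`Literature.Topology.Algebra.exists_openSubgroup_trivialOn`, which is the `Circle`-valued case).  Continuity is asked of `b ↦ (φ b : ℂ)`.
[cite: CartierCorvallis1979, §I.1] -/
theorem exists_openSubgroup_forall_unitsComplex_eq_one [NonarchimedeanGroup G] (B : Subgroup G) (φ : B →* ℂˣ)
    (hφ : Continuous fun b => ((φ b : ℂˣ) : ℂ)) :
    ∃ K : OpenSubgroup G, ∀ b : B, (b : G) ∈ (K : Set G) → φ b = 1 := by
  have hφ' : Continuous φ := Units.isEmbedding_val₀.continuous_iff.2 hφ
  obtain ⟨Nb, hNo, hN1, hNpow⟩ := unitsComplex_noSmallSubgroups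
  have hU : (φ : B → ℂˣ) ⁻¹' Nb ∈ 𝓝 (1 : B) :=
    Literature.Topology.Algebra.preimage_mem_nhds_one hφ' (hNo.mem_nhds hN1)
  rw [nhds_subtype_eq_comap] at hU
  obtain ⟨U', hU', hsub⟩ := hU
  obtain ⟨K, hK⟩ := NonarchimedeanGroup.is_nonarchimedean U' (by simpa using hU')
  refine ⟨K, fun b hb => ?_⟩
  have hle : (K : Subgroup G).comap B.subtype ≤ φ.ker :=
    Literature.Topology.Algebra.subgroup_le_ker_of_subset_preimage hNpow _ fun x hx => hsub (hK hx)
  exact hle (show b ∈ (K : Subgroup G).comap B.subtype from hb)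

end NoSmall

/-! ## §3 `δ_P^{1/2}` is trivial on a unipotent radical which is a limit of compact open subgroups -/

section Delta

variable {G : Type*} [Group G] [TopologicalSpace G] [IsTopologicalGroup G] (t : ParabolicTriple G) [LocallyCompactSpace t.P]

/-- **`δ_P^{1/2}(n) = 1` for `n ∈ N`** when `N` is the union of its compact open subgroups: `n` lies in a compact open `K ≤ N`, whose image
in `P` is a compact subgroup, on which the modulus is trivial (★ `rootDeltaChar_eq_one_of_mem_of_isCompact`).  This is [BernsteinZelevinsky1977]'s
standing hypothesis «`Δ` is trivial on `U`» of §1.8–1.9. [cite: BernsteinZelevinsky1977, 1.7 and §1.9] [cite: CartierCorvallis1979, §III.3] -/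
theorem ParabolicTriple.rootDeltaChar_eq_one_of_mem_N (hN : IsLimitOfCompactOpen t.N) {n : G} (hn : n ∈ t.N) :
    rootDeltaChar t.P ⟨n, t.N_le hn⟩ = 1 := by
  obtain ⟨K, -, hKc, hsub⟩ := hN {⟨n, hn⟩} isCompact_singleton
  let φ : t.N →* t.P := Subgroup.inclusion t.N_le
  have hφ : Continuous φ := continuous_inclusion t.N_le
  refine rootDeltaChar_eq_one_of_mem_of_isCompact t.P (C := K.map φ) (hKc.image hφ) ?_
  exact ⟨⟨n, hn⟩, hsub (Set.mem_singleton _), rfl⟩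

/-- **the inducing representation `σ ∘ proj ⊗ δ_P^{1/2}` of `i_P^G σ` is trivial on `N`** (`proj` kills `N`, ★ `ParabolicTriple.proj_apply_of_mem_N`,
and `δ_P^{1/2}|_N = 1`). [cite: BernsteinZelevinsky1977, §1.8 and §2.3] -/
theorem ParabolicTriple.twist_comp_proj_apply_of_mem_N (hN : IsLimitOfCompactOpen t.N) {W : Type*} [AddCommGroup W] [Module ℂ W]
    (σ : Representation ℂ t.M W) {n : G} (hn : n ∈ t.N) (w : W) :
    Representation.twist (σ.comp t.proj) (rootDeltaChar t.P) ⟨n, t.N_le hn⟩ w = w := by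
  rw [Representation.twist_apply, t.rootDeltaChar_eq_one_of_mem_N hN hn, Units.val_one, one_smul, MonoidHom.comp_apply,
    t.proj_apply_of_mem_N _ hn, map_one, Module.End.one_apply]

end Delta

/-! ## §4 Evaluation at `1` descends to the Jacquet module of `i_P^G σ` -/

section EvalOne

variable {G : Type*} [Group G] [TopologicalSpace G] [IsTopologicalGroup G] (t : ParabolicTriple G) [LocallyCompactSpace t.P]
  {W : Type*} [AddCommGroup W] [Module ℂ W] (σ : Representation ℂ t.M W)

/-- **`(n · f)(1) = f(1)` for `n ∈ N` and `f ∈ i_P^G σ`** (`(n · f)(1) = f(n) = (σ∘proj ⊗ δ^{1/2})(n) f(1) = f(1)`): evaluation at `1` is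
`N`-invariant. [cite: BernsteinZelevinsky1977, §1.8 and §2.3] [cite: Casselman1995, §6.3 (proof of Thm. 6.3.5)] -/
theorem ParabolicTriple.toFun_one_normalizedInd_apply_of_mem_N (hN : IsLimitOfCompactOpen t.N) {n : G} (hn : n ∈ t.N)
    (f : Representation.SmoothInd t.P (Representation.twist (σ.comp t.proj) (rootDeltaChar t.P))) :
    (Representation.normalizedInd t σ n f).toFun 1 = f.toFun 1 := by
  change (Representation.smoothIndRep t.P _ n f).toFun 1 = f.toFun 1
  rw [Representation.toFun_smoothIndRep_apply, one_mul, ← mul_one n,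
    show n * 1 = ((⟨n, t.N_le hn⟩ : t.P) : G) * 1 from rfl, f.toFun_subgroup_mul,
    t.twist_comp_proj_apply_of_mem_N hN σ hn]

/-- **Evaluation at `1` descends to the Jacquet module**: there is a linear map `E : (r_P i_P^G σ)‑carrier → W` with `E [f] = f(1)` for every
`f ∈ i_P^G σ` (Mathlib `Representation.Coinvariants.lift` of `f ↦ f(1)`, `N`-invariant by the previous lemma).  The closed-cell term of the
Geometrical Lemma: `E` is the map `r_P i_P^G σ → σ ⊗ δ^{1/2}` of [Casselman1995, Lemma 7.1.1 (a)] on carriers.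
[cite: BernsteinZelevinsky1977, Geometrical Lemma 2.12 (closed orbit) and §2.3] [cite: Casselman1995, Lemma 7.1.1 (a)] -/
theorem ParabolicTriple.exists_linearMap_coinvariants_mk_eq_toFun_one (hN : IsLimitOfCompactOpen t.N) :
    ∃ E : (t.restrict (Representation.normalizedInd t σ)).Coinvariants →ₗ[ℂ] W,
      ∀ f, E (Representation.Coinvariants.mk _ f) = f.toFun 1 := by
  let ev : Representation.SmoothInd t.P (Representation.twist (σ.comp t.proj) (rootDeltaChar t.P)) →ₗ[ℂ] W :=
    { toFun := fun f => f.toFun 1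
      map_add' := fun f g => rfl
      map_smul' := fun c f => rfl }
  have hev : ∀ n : ↥(t.N.subgroupOf t.P), ev ∘ₗ (t.restrict (Representation.normalizedInd t σ)) n = ev := fun n => by
    ext f
    exact t.toFun_one_normalizedInd_apply_of_mem_N σ hN (Subgroup.mem_subgroupOf.1 n.2) f
  exact ⟨Representation.Coinvariants.lift _ ev hev, fun f => rfl⟩

/-- **`[f] ≠ 0` in the Jacquet module whenever `f(1) ≠ 0`** — the closed Bruhat cell contributes to `r_P i_P^G σ`.
[cite: BernsteinZelevinsky1977, Geometrical Lemma 2.12 (closed orbit)] [cite: Casselman1995, Lemma 7.1.1 (a)] -/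
theorem ParabolicTriple.mk_restrict_normalizedInd_ne_zero_of_toFun_one_ne_zero (hN : IsLimitOfCompactOpen t.N)
    (f : Representation.SmoothInd t.P (Representation.twist (σ.comp t.proj) (rootDeltaChar t.P))) (hf : f.toFun 1 ≠ 0) :
    Representation.Coinvariants.mk (t.restrict (Representation.normalizedInd t σ)) f ≠ 0 := by
  obtain ⟨E, hE⟩ := t.exists_linearMap_coinvariants_mk_eq_toFun_one σ hN
  intro h
  apply hf
  rw [← hE f, h, map_zero]

/-- **the descended evaluation separates the closed cell from the open one**: if `ℓ` is a subspace of the Jacquet module all of whose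
elements are classes of functions vanishing at `1` (e.g. the image of the functions supported in the open cell), then a class `[f]` with
`f(1) ≠ 0` does not lie in `ℓ`. [cite: BernsteinZelevinsky1977, Geometrical Lemma 2.12] [cite: Casselman1995, §6.3 (proof of Thm. 6.3.5)] -/
theorem ParabolicTriple.mk_restrict_normalizedInd_notMem_of_toFun_one_ne_zero (hN : IsLimitOfCompactOpen t.N)
    (ℓ : Submodule ℂ (t.restrict (Representation.normalizedInd t σ)).Coinvariants)
    (hℓ : ∀ x ∈ ℓ, ∃ g : Representation.SmoothInd t.P (Representation.twist (σ.comp t.proj) (rootDeltaChar t.P)),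
      g.toFun 1 = 0 ∧ Representation.Coinvariants.mk _ g = x)
    (f : Representation.SmoothInd t.P (Representation.twist (σ.comp t.proj) (rootDeltaChar t.P))) (hf : f.toFun 1 ≠ 0) :
    Representation.Coinvariants.mk (t.restrict (Representation.normalizedInd t σ)) f ∉ ℓ := by
  obtain ⟨E, hE⟩ := t.exists_linearMap_coinvariants_mk_eq_toFun_one σ hN
  intro hmem
  obtain ⟨g, hg0, hg⟩ := hℓ _ hmem
  apply hf
  rw [← hE f, ← hg, hE g, hg0]

/-! ## §5 A section with prescribed value at `1` -/

/-- **A `K`-fixed section of `i_P^G σ` with `f(1) = w`**, for an OPEN subgroup `K ≤ G` and a vector `w` fixed by `(σ∘proj ⊗ δ_P^{1/2})(P ∩ K)`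
— ★ `Representation.exists_mem_fixedPoints_toFun_eq_of_isOpen` (the section `σ'(p) w` on `P·K`, `0` elsewhere) read for normalised induction.
[cite: BernsteinZelevinsky1977, §2.3] [cite: Casselman1995, §6.3] -/
theorem ParabolicTriple.exists_normalizedInd_toFun_one_eq {K : Subgroup G} (hKo : IsOpen (K : Set G)) {w : W}
    (hw : ∀ p : t.P, (p : G) ∈ K → Representation.twist (σ.comp t.proj) (rootDeltaChar t.P) p w = w) :
    ∃ f : Representation.SmoothInd t.P (Representation.twist (σ.comp t.proj) (rootDeltaChar t.P)),
      f ∈ (Representation.normalizedInd t σ).fixedPoints K ∧ f.toFun 1 = w := by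
  obtain ⟨f, hfK, hf1, -, -⟩ := Representation.exists_mem_fixedPoints_toFun_eq_of_isOpen
    (Representation.twist (σ.comp t.proj) (rootDeltaChar t.P)) hKo (w := w)
    ((Representation.mem_fixedPoints _ _ w).2 fun p hp => hw p (Subgroup.mem_subgroupOf.1 hp))
  exact ⟨f, hfK, hf1⟩

/-- **The closed cell survives in the Jacquet module**: under the hypotheses of the previous lemma with `w ≠ 0`, some `f ∈ i_P^G σ` has
`[f] ≠ 0` in `r_P i_P^G σ` and `f(1) = w`; with §4 the descended evaluation `E` is then a NON-ZERO linear form on the Jacquet-module carrier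
killing the open-cell classes. [cite: BernsteinZelevinsky1977, Geometrical Lemma 2.12 (closed orbit)] [cite: Casselman1995, Lemma 7.1.1 (a)] -/
theorem ParabolicTriple.exists_mk_restrict_normalizedInd_ne_zero (hN : IsLimitOfCompactOpen t.N) {K : Subgroup G}
    (hKo : IsOpen (K : Set G)) {w : W} (hw0 : w ≠ 0)
    (hw : ∀ p : t.P, (p : G) ∈ K → Representation.twist (σ.comp t.proj) (rootDeltaChar t.P) p w = w) :
    ∃ f : Representation.SmoothInd t.P (Representation.twist (σ.comp t.proj) (rootDeltaChar t.P)),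
      f.toFun 1 = w ∧ Representation.Coinvariants.mk (t.restrict (Representation.normalizedInd t σ)) f ≠ 0 := by
  obtain ⟨f, -, hf1⟩ := t.exists_normalizedInd_toFun_one_eq σ hKo hw
  exact ⟨f, hf1, t.mk_restrict_normalizedInd_ne_zero_of_toFun_one_ne_zero σ hN f (by rw [hf1]; exact hw0)⟩

end EvalOne

/-! ## §6 One-dimensional inducing data: the open subgroup from continuity -/

section Character

variable {G : Type*} [Group G] [TopologicalSpace G] [NonarchimedeanGroup G] (t : ParabolicTriple G) [LocallyCompactSpace t.P]

/-- **For a character `χ` of `M` with `p ↦ χ(proj p)` continuous on `P`, `P` closed, and a compact open subgroup `K₀ ≤ G` of a NON-ARCHIMEDEAN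
`G`, there is an open subgroup `K ≤ G` on whose trace `P ∩ K` the inducing character `χ∘proj · δ_P^{1/2}` is trivial** (`χ∘proj` by §2,
`δ_P^{1/2}` on `P ∩ K₀` by ★ `rootDeltaChar_eq_one_of_mem_of_isClosed_of_isCompact`). [cite: CartierCorvallis1979, §I.1 and §III.3] [cite: BernsteinZelevinsky1977, §2.3] -/
theorem ParabolicTriple.exists_isOpen_forall_twist_comp_proj_eq_one (hP : IsClosed (t.P : Set G))
    {K₀ : Subgroup G} (hK₀o : IsOpen (K₀ : Set G)) (hK₀c : IsCompact (K₀ : Set G)) (χ : t.M →* ℂˣ)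
    (hχ : Continuous fun p : t.P => ((χ (t.proj p) : ℂˣ) : ℂ)) :
    ∃ K : Subgroup G, IsOpen (K : Set G) ∧ ∀ p : t.P, (p : G) ∈ K →
      ∀ w : ℂ, Representation.twist (((Representation.trivial ℂ t.M ℂ).twist χ).comp t.proj) (rootDeltaChar t.P) p w = w := by
  obtain ⟨K₁, hK₁⟩ := exists_openSubgroup_forall_unitsComplex_eq_one t.P (χ.comp t.proj) hχ
  refine ⟨(K₁ : Subgroup G) ⊓ K₀, K₁.isOpen.inter hK₀o, fun p hp w => ?_⟩
  have h1 : χ (t.proj p) = 1 := hK₁ p hp.1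
  have h2 : rootDeltaChar t.P p = 1 := rootDeltaChar_eq_one_of_mem_of_isClosed_of_isCompact t.P hP hK₀c hp.2
  rw [Representation.twist_apply, h2, Units.val_one, one_smul, MonoidHom.comp_apply, Representation.twist_apply, h1, Units.val_one,
    one_smul, Representation.trivial_apply]

/-- **THE CLOSED CELL IN THE JACQUET MODULE OF `i_P^G χ`, one-dimensional data**: for `G` non-archimedean with a compact open subgroup, `P` closed,
`N` the union of its compact open subgroups and `χ∘proj` continuous on `P`, there are `f ∈ i_P^G χ` with `f(1) = 1` (so `i_P^G χ ≠ 0`) and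
`[f] ≠ 0` in `r_P i_P^G χ`, together with the descended evaluation `E`, `E [g] = g(1)`, a non-zero linear form on the Jacquet-module carrier.
[cite: BernsteinZelevinsky1977, Geometrical Lemma 2.12 (closed orbit) and §2.3] [cite: Casselman1995, Lemma 7.1.1 (a)] -/
theorem ParabolicTriple.exists_toFun_one_eq_one_and_mk_ne_zero (hP : IsClosed (t.P : Set G))
    (hN : IsLimitOfCompactOpen t.N) {K₀ : Subgroup G} (hK₀o : IsOpen (K₀ : Set G)) (hK₀c : IsCompact (K₀ : Set G)) (χ : t.M →* ℂˣ)
    (hχ : Continuous fun p : t.P => ((χ (t.proj p) : ℂˣ) : ℂ)) :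
    ∃ f : Representation.SmoothInd t.P
        (Representation.twist (((Representation.trivial ℂ t.M ℂ).twist χ).comp t.proj) (rootDeltaChar t.P)),
      f.toFun 1 = 1 ∧
        Representation.Coinvariants.mk (t.restrict (Representation.normalizedInd t ((Representation.trivial ℂ t.M ℂ).twist χ))) f ≠ 0 := by
  obtain ⟨K, hKo, hK⟩ := t.exists_isOpen_forall_twist_comp_proj_eq_one hP hK₀o hK₀c χ hχ
  exact t.exists_mk_restrict_normalizedInd_ne_zero _ hN hKo one_ne_zero fun p hp => hK p hp 1

/-- **… and the descended evaluation `E`, `E [g] = g(1)`, is a NON-ZERO linear form on the Jacquet-module carrier** (same hypotheses).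
[cite: BernsteinZelevinsky1977, Geometrical Lemma 2.12 (closed orbit)] [cite: Casselman1995, Lemma 7.1.1 (a)] -/
theorem ParabolicTriple.exists_linearMap_coinvariants_ne_zero (hP : IsClosed (t.P : Set G))
    (hN : IsLimitOfCompactOpen t.N) {K₀ : Subgroup G} (hK₀o : IsOpen (K₀ : Set G)) (hK₀c : IsCompact (K₀ : Set G)) (χ : t.M →* ℂˣ)
    (hχ : Continuous fun p : t.P => ((χ (t.proj p) : ℂˣ) : ℂ)) :
    ∃ E : (t.restrict (Representation.normalizedInd t ((Representation.trivial ℂ t.M ℂ).twist χ))).Coinvariants →ₗ[ℂ] ℂ,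
      (∀ f, E (Representation.Coinvariants.mk _ f) = f.toFun 1) ∧ E ≠ 0 := by
  obtain ⟨E, hE⟩ := t.exists_linearMap_coinvariants_mk_eq_toFun_one ((Representation.trivial ℂ t.M ℂ).twist χ) hN
  obtain ⟨f, hf1, -⟩ := t.exists_toFun_one_eq_one_and_mk_ne_zero hP hN hK₀o hK₀c χ hχ
  refine ⟨E, hE, fun h0 => one_ne_zero (α := ℂ) ?_⟩
  have h := hE f
  rw [h0, LinearMap.zero_apply, hf1] at h
  exact h.symm

end Character

end Literature.NumberTheory.Automorphic

end
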